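import Mathlib.Analysis.Calculus.Deriv.Inv
import Mathlib.Analysis.Calculus.Deriv.Mul
import Mathlib.Analysis.Calculus.Deriv.Add
import Mathlib.Analysis.Calculus.Deriv.Pow
import Mathlib.Analysis.SpecialFunctions.Complex.Analytic
import Mathlib.Tactic.FieldSimp
import Mathlib.Tactic.Ring
import Mathlib.Tactic.Linarith
import HarnessLib

/-!
# The Möbius conjugation of the chordal Loewner flow: Lawler's `ḣ_t(W_t) = -3 h_t''(W_t)` and the
# `κ = 6` cancellation, in closed form

Topic `Probability/RandomPlanarGeometry`. Deterministic algebra behind the locality computation of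
G. F. Lawler, *Conformally Invariant Processes in the Plane* (2005), §4.6.1 (4.35) and §6.3
(Thm. 6.13, Prop. 6.14), in the special case — the only one needed for TARGET INDEPENDENCE
(Prop. 6.14, LSW (2001) Cor. 2.3; tree: `sle_six_moebius_locality`, `SLESixMoebiusLocality.lean`)
— where the conformal map is a MÖBIUS automorphism `N(w) = a + b/(p - w)` (`b > 0`, pole `p`) of
`ℍ` rather than the normalising map of a hull.

For the chordal Loewner chain `(g_t)` driven by `W` and `t < T_p` (the pole not yet swallowed),
the image hulls `N(K_t)` are normalised by `g̃ = h_t ∘ g_t ∘ N⁻¹` with `h_t : ℍ → ℍ` conformal AND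
Möbius (a composition of conformal automorphisms of `ℍ`), `h_t(P_t) = ∞` where `P_t = g_t(p)` is
the real Loewner flow of the pole. Expanding `g̃` at `∞` (`N⁻¹(z) = p - b/(z - a)`,
`g_t(w) = P_t + d₁(w - p) + d₂(w - p)²/2 + ⋯`, `d_k = g_t^{(k)}(p)`), the hydrodynamic
normalisation `g̃(z) = z + O(1/z)` forces the CLOSED FORM

  `h_t(y) = a - b d₂/(2 d₁) + b d₁/(P_t - y)`            (`moebiusConj a b P d₁ d₂ y`),

so that in the Möbius case the "random conformal map `Φ_t`" of Lawler's §6.3 is an explicit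
function of the four real processes `W_t`, `P_t = g_t(p)`, `d₁ = g_t'(p)`, `d₂ = g_t''(p)`, which
solve the `x`-derivatives of Loewner's equation `ġ = 2/(g - W)`:

  `Ṗ = 2/(P - W)`,  `ḋ₁ = -2 d₁/(P - W)²`,  `ḋ₂ = -2 d₂/(P - W)² + 4 d₁²/(P - W)³`.

This file PROVES, by the chain rule along ANY differentiable `P, d₁, d₂` satisfying these three
equations at a time `t` (no Loewner theory is imported; the equations are the hypotheses):

* `hasDerivAt_moebiusConj_apply` — **the image chain satisfies Loewner's equation** (Lawler
  §4.6.1, LSW (2003) (5.1) for Möbius `N`): for fixed `y`,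
  `∂_t h_t(y) = 2 h_t'(W)²/(h_t(y) - h_t(W)) - h_t'(y) · 2/(y - W)`, i.e. along a Loewner
  trajectory `y_t = g_t(w)` (`ẏ = 2/(y - W)`), `d/dt h_t(y_t) = 2 h_t'(W_t)²/(h_t(y_t) - h_t(W_t))`:
  after the time change `du = h_t'(W_t)² dt` the maps `g̃ = h_t ∘ g_t ∘ N⁻¹` solve Loewner's
  equation with driving function `W̃ = h_t(W_t)`;
* `hasDerivAt_moebiusConj_frozen` — **Lawler's (4.35)** `ḣ_t(W_t) = -3 h_t''(W_t)` (time
  derivative with the argument frozen at `W_t`);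
* `moebiusConj_drift` — hence the `dt`-coefficient of `d[h_t(W_t)]` given by Itô's formula for a
  driving function `W = √κ B`, `ḣ_t(W_t) + (κ/2) h_t''(W_t)`, equals `(κ - 6) b d₁/(P - W)³`
  (Lawler §6.3: "`dU*_t = [κ/2 - 3] Φ_t''(U_t) dt + √κ Φ_t'(U_t) dB_t`"), and
  `moebiusConj_drift_six` — **it vanishes identically iff `κ = 6`**;
* `deriv` bookkeeping: `h_t'(y) = b d₁/(P - y)²`, `h_t''(y) = 2 b d₁/(P - y)³`
  (`hasDerivAt_moebiusConj`, `hasDerivAt_deriv_moebiusConj`), and the consistency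
  `moebiusConj a b p 1 0 = N` at `t = 0` (`moebiusConj_init`);
* `moebiusConjC`, `hasDerivAt_moebiusConjC_trajectory` — the same map at complex arguments and
  **the image of a complex Loewner trajectory `Ẏ = 2/(Y - W)` solves the image Loewner equation**
  `d/dt h_t(Y_t) = 2 h_t'(W_t)²/(h_t(Y_t) - h_t(W_t))` (Lawler §6.3, "the maps `g*_t` satisfy the
  Loewner equation `ġ*_t = 2Φ_t'(U_t)²/(g*_t - U*_t)`"), the input of the deterministic transport
  `hull W̃ (u t) = N(hull W t)` after the time change `u = ∫ h_s'(W_s)² ds`.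

What is NOT here: that `P_t, g_t'(p), g_t''(p)` exist and solve these equations for the actual
Loewner flow (differentiate `LoewnerMapProofs.hasDerivAt_map` in `x`), the capacity
`hcap N(K_t) = -b² (Sg_t)(p)/6` and `d/dt hcap = 2 h_t'(W_t)²`, Itô's formula and the time change
(the probabilistic part of Lawler's Thm. 6.13).

## References

* G. F. Lawler, *Conformally Invariant Processes in the Plane*, AMS (2005), §4.6.1 (4.35),
  §6.3 Thm. 6.13, Prop. 6.14. [Lawler2005]
* G. F. Lawler, O. Schramm, W. Werner, *Conformal restriction: the chordal case*, J. Amer. Math.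
  Soc. 16 (2003), §5 (5.1). [LawlerSchrammWerner2003Restriction]
-/

noncomputable section

open Set Filter Topology

namespace Literature.Probability.RandomPlanarGeometry

/-! ### The conjugating Möbius map in closed form -/

/-- **The Möbius conjugation `h_t = g̃_t ∘ N ∘ g_t⁻¹` in closed form**: for the Möbius map
`N(w) = a + b/(p - w)` of `ℍ` and the chordal Loewner maps `g_t` (pole flow `P = g_t(p)`, spatial
derivatives `d₁ = g_t'(p)`, `d₂ = g_t''(p)`), the hydrodynamically normalised image chain has
`h_t(y) = a - b d₂/(2 d₁) + b d₁/(P - y)` (junk `y = P ↦ a - b d₂/(2 d₁)` by `r/0 = 0`).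
Lawler (2005), §4.6.1 (`Φ_t = g*_t ∘ Φ ∘ g_t⁻¹`) for Möbius `Φ`. [cite: Lawler2005, §4.6.1] -/
def moebiusConj (a b P d₁ d₂ y : ℝ) : ℝ :=
  a - b * d₂ / (2 * d₁) + b * d₁ / (P - y)

/-- Unfolding `moebiusConj`. [folklore] -/
theorem moebiusConj_apply (a b P d₁ d₂ y : ℝ) :
    moebiusConj a b P d₁ d₂ y = a - b * d₂ / (2 * d₁) + b * d₁ / (P - y) := rfl

/-- **Consistency at `t = 0`** (`g_0 = id`: `P = p`, `d₁ = 1`, `d₂ = 0`): `h_0 = N`,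
`N(y) = a + b/(p - y)`. [folklore] -/
theorem moebiusConj_init (a b p y : ℝ) : moebiusConj a b p 1 0 y = a + b / (p - y) := by
  simp [moebiusConj]

/-- Lawler's re-targeting map `Φ_x(y) = x y/(y + x)` is the Möbius map `N` with `a = x`, `b = x²`,
`p = -x`: `x y/(y + x) = x + x²/(-x - y)` off the pole. [cite: Lawler2005, §6.3] -/
theorem retarget_eq_moebiusConj_init {x y : ℝ} (hy : y + x ≠ 0) :
    x * y / (y + x) = moebiusConj x (x ^ 2) (-x) 1 0 y := by
  rw [moebiusConj_init]
  have h : -x - y ≠ 0 := by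
    intro h0
    apply hy
    linarith
  field_simp
  ring

/-! ### Spatial derivatives -/

/-- **`h_t'(y) = b d₁/(P - y)²`** for `y ≠ P`. [folklore] -/
theorem hasDerivAt_moebiusConj {a b P d₁ d₂ y : ℝ} (hy : y ≠ P) :
    HasDerivAt (moebiusConj a b P d₁ d₂) (b * d₁ / (P - y) ^ 2) y := by
  have hPy : P - y ≠ 0 := sub_ne_zero.2 (Ne.symm hy)
  have h1 : HasDerivAt (fun z : ℝ ↦ P - z) (-1) y := (hasDerivAt_id y).const_sub P
  have h2 : HasDerivAt (fun z : ℝ ↦ b * d₁ / (P - z)) ((0 * (P - y) - b * d₁ * (-1)) / (P - y) ^ 2) y :=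
    (hasDerivAt_const y (b * d₁)).div h1 hPy
  have h3 : HasDerivAt (fun z : ℝ ↦ a - b * d₂ / (2 * d₁) + b * d₁ / (P - z))
      (0 + (0 * (P - y) - b * d₁ * (-1)) / (P - y) ^ 2) y :=
    (hasDerivAt_const y _).add h2
  refine (h3.congr_deriv ?_)
  ring

/-- **`h_t''(y) = 2 b d₁/(P - y)³`** for `y ≠ P` (derivative of `y ↦ b d₁/(P - y)²`). [folklore] -/
theorem hasDerivAt_deriv_moebiusConj {b P d₁ y : ℝ} (hy : y ≠ P) :
    HasDerivAt (fun y : ℝ ↦ b * d₁ / (P - y) ^ 2) (2 * b * d₁ / (P - y) ^ 3) y := by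
  have hPy : P - y ≠ 0 := sub_ne_zero.2 (Ne.symm hy)
  have h1 : HasDerivAt (fun z : ℝ ↦ P - z) (-1) y := (hasDerivAt_id y).const_sub P
  have h2 : HasDerivAt (fun z : ℝ ↦ (P - z) ^ 2) ((2 : ℕ) * (P - y) ^ (2 - 1) * (-1)) y :=
    h1.pow 2
  have h3 : HasDerivAt (fun z : ℝ ↦ b * d₁ / (P - z) ^ 2)
      ((0 * ((P - y) ^ 2) - b * d₁ * ((2 : ℕ) * (P - y) ^ (2 - 1) * (-1))) / ((P - y) ^ 2) ^ 2) y :=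
    (hasDerivAt_const y (b * d₁)).div h2 (pow_ne_zero 2 hPy)
  refine h3.congr_deriv ?_
  push_cast
  field_simp
  ring

/-! ### Time derivatives along the derivative flow of the pole -/

section Flow

variable {a b : ℝ} {P d₁ d₂ : ℝ → ℝ} {W t : ℝ}

/-- **The image chain satisfies Loewner's equation** (Lawler §4.6.1; LSW (2003) (5.1) for a
Möbius `N`). Along differentiable `P, d₁, d₂` satisfying at time `t` the `x`-derivatives of
Loewner's equation at the pole, `Ṗ = 2/(P - W)`, `ḋ₁ = -2 d₁/(P - W)²`,
`ḋ₂ = -2 d₂/(P - W)² + 4 d₁²/(P - W)³` (`W = W_t`, `P ≠ W`, `d₁ ≠ 0`), for every fixed `y ∉ {P, W}`: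
`∂_t h_t(y) = 2 h_t'(W)²/(h_t(y) - h_t(W)) - h_t'(y) · 2/(y - W)`,
with `h_t' (y) = b d₁/(P - y)²`. Equivalently, along a Loewner trajectory `ẏ = 2/(y - W)`,
`d/dt h_t(y_t) = 2 h_t'(W_t)² /(h_t(y_t) - h_t(W_t))`. [cite: Lawler2005, §4.6.1] -/
theorem hasDerivAt_moebiusConj_apply (hP : HasDerivAt P (2 / (P t - W)) t)
    (hd₁ : HasDerivAt d₁ (-2 * d₁ t / (P t - W) ^ 2) t)
    (hd₂ : HasDerivAt d₂ (-2 * d₂ t / (P t - W) ^ 2 + 4 * d₁ t ^ 2 / (P t - W) ^ 3) t)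
    (hPW : P t ≠ W) (hd₁0 : d₁ t ≠ 0) {y : ℝ} (hyP : y ≠ P t) (hyW : y ≠ W) :
    HasDerivAt (fun s ↦ moebiusConj a b (P s) (d₁ s) (d₂ s) y)
      (2 * (b * d₁ t / (P t - W) ^ 2) ^ 2 /
          (moebiusConj a b (P t) (d₁ t) (d₂ t) y - moebiusConj a b (P t) (d₁ t) (d₂ t) W) -
        b * d₁ t / (P t - y) ^ 2 * (2 / (y - W))) t := by
  have hu : P t - W ≠ 0 := sub_ne_zero.2 hPW
  have hv : P t - y ≠ 0 := sub_ne_zero.2 (Ne.symm hyP)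
  have hyw : y - W ≠ 0 := sub_ne_zero.2 hyW
  -- the summands of `h` along the flow
  have hnum : HasDerivAt (fun s ↦ b * d₂ s) (b * (-2 * d₂ t / (P t - W) ^ 2 +
      4 * d₁ t ^ 2 / (P t - W) ^ 3)) t := hd₂.const_mul b
  have hden : HasDerivAt (fun s ↦ 2 * d₁ s) (2 * (-2 * d₁ t / (P t - W) ^ 2)) t := hd₁.const_mul 2
  have hA : HasDerivAt (fun s ↦ b * d₂ s / (2 * d₁ s))
      ((b * (-2 * d₂ t / (P t - W) ^ 2 + 4 * d₁ t ^ 2 / (P t - W) ^ 3) * (2 * d₁ t) -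
        b * d₂ t * (2 * (-2 * d₁ t / (P t - W) ^ 2))) / (2 * d₁ t) ^ 2) t :=
    hnum.div hden (mul_ne_zero two_ne_zero hd₁0)
  have hnum' : HasDerivAt (fun s ↦ b * d₁ s) (b * (-2 * d₁ t / (P t - W) ^ 2)) t := hd₁.const_mul b
  have hden' : HasDerivAt (fun s ↦ P s - y) (2 / (P t - W)) t := hP.sub_const y
  have hB : HasDerivAt (fun s ↦ b * d₁ s / (P s - y))
      ((b * (-2 * d₁ t / (P t - W) ^ 2) * (P t - y) - b * d₁ t * (2 / (P t - W))) /
        (P t - y) ^ 2) t :=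
    hnum'.div hden' hv
  have hsum : HasDerivAt (fun s ↦ a - b * d₂ s / (2 * d₁ s) + b * d₁ s / (P s - y))
      (0 - ((b * (-2 * d₂ t / (P t - W) ^ 2 + 4 * d₁ t ^ 2 / (P t - W) ^ 3) * (2 * d₁ t) -
        b * d₂ t * (2 * (-2 * d₁ t / (P t - W) ^ 2))) / (2 * d₁ t) ^ 2) +
        (b * (-2 * d₁ t / (P t - W) ^ 2) * (P t - y) - b * d₁ t * (2 / (P t - W))) /
          (P t - y) ^ 2) t :=
    ((hasDerivAt_const t a).sub hA).add hB
  refine hsum.congr_deriv ?_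
  -- the algebraic identity (LSW (5.1) for Möbius maps)
  have hdiff : moebiusConj a b (P t) (d₁ t) (d₂ t) y - moebiusConj a b (P t) (d₁ t) (d₂ t) W =
      b * d₁ t * (y - W) / ((P t - y) * (P t - W)) := by
    rw [moebiusConj_apply, moebiusConj_apply]
    field_simp
    ring
  rw [hdiff]
  by_cases hb : b = 0
  · subst hb
    simp
  have hprod : b * d₁ t * (y - W) / ((P t - y) * (P t - W)) ≠ 0 :=
    div_ne_zero (mul_ne_zero (mul_ne_zero hb hd₁0) hyw) (mul_ne_zero hv hu)
  field_simp
  ring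

/-- **Lawler's (4.35), `ḣ_t(W_t) = -3 h_t''(W_t)`, for the Möbius conjugation**: the time
derivative of `h_t` with its argument frozen at `W = W_t` is `-6 b d₁/(P - W)³ = -3 h_t''(W)`
(`h_t''(W) = 2 b d₁/(P - W)³`, `hasDerivAt_deriv_moebiusConj`). [cite: Lawler2005, §4.6.1 (4.35)] -/
theorem hasDerivAt_moebiusConj_frozen (hP : HasDerivAt P (2 / (P t - W)) t)
    (hd₁ : HasDerivAt d₁ (-2 * d₁ t / (P t - W) ^ 2) t)
    (hd₂ : HasDerivAt d₂ (-2 * d₂ t / (P t - W) ^ 2 + 4 * d₁ t ^ 2 / (P t - W) ^ 3) t)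
    (hPW : P t ≠ W) (hd₁0 : d₁ t ≠ 0) :
    HasDerivAt (fun s ↦ moebiusConj a b (P s) (d₁ s) (d₂ s) W)
      (-3 * (2 * b * d₁ t / (P t - W) ^ 3)) t := by
  have hu : P t - W ≠ 0 := sub_ne_zero.2 hPW
  have hnum : HasDerivAt (fun s ↦ b * d₂ s) (b * (-2 * d₂ t / (P t - W) ^ 2 +
      4 * d₁ t ^ 2 / (P t - W) ^ 3)) t := hd₂.const_mul b
  have hden : HasDerivAt (fun s ↦ 2 * d₁ s) (2 * (-2 * d₁ t / (P t - W) ^ 2)) t := hd₁.const_mul 2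
  have hA : HasDerivAt (fun s ↦ b * d₂ s / (2 * d₁ s))
      ((b * (-2 * d₂ t / (P t - W) ^ 2 + 4 * d₁ t ^ 2 / (P t - W) ^ 3) * (2 * d₁ t) -
        b * d₂ t * (2 * (-2 * d₁ t / (P t - W) ^ 2))) / (2 * d₁ t) ^ 2) t :=
    hnum.div hden (mul_ne_zero two_ne_zero hd₁0)
  have hnum' : HasDerivAt (fun s ↦ b * d₁ s) (b * (-2 * d₁ t / (P t - W) ^ 2)) t := hd₁.const_mul b
  have hden' : HasDerivAt (fun s ↦ P s - W) (2 / (P t - W)) t := hP.sub_const W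
  have hB : HasDerivAt (fun s ↦ b * d₁ s / (P s - W))
      ((b * (-2 * d₁ t / (P t - W) ^ 2) * (P t - W) - b * d₁ t * (2 / (P t - W))) /
        (P t - W) ^ 2) t :=
    hnum'.div hden' hu
  have hsum : HasDerivAt (fun s ↦ a - b * d₂ s / (2 * d₁ s) + b * d₁ s / (P s - W))
      (0 - ((b * (-2 * d₂ t / (P t - W) ^ 2 + 4 * d₁ t ^ 2 / (P t - W) ^ 3) * (2 * d₁ t) -
        b * d₂ t * (2 * (-2 * d₁ t / (P t - W) ^ 2))) / (2 * d₁ t) ^ 2) +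
        (b * (-2 * d₁ t / (P t - W) ^ 2) * (P t - W) - b * d₁ t * (2 / (P t - W))) /
          (P t - W) ^ 2) t :=
    ((hasDerivAt_const t a).sub hA).add hB
  refine hsum.congr_deriv ?_
  field_simp
  ring

end Flow

/-! ### The drift of `h_t(W_t)` and its vanishing at `κ = 6` -/

/-- **The `dt`-coefficient of `d[h_t(W_t)]` for a driving function `W = √κ B`**: by Itô's
formula it is `ḣ_t(W_t) + (κ/2) h_t''(W_t)` (Lawler (2005), Prop. 1.9 with (4.35)), which for the
Möbius conjugation equals `(κ - 6) b d₁/(P - W)³` (`ḣ_t(W_t) = -6 b d₁/(P - W)³`,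
`h_t''(W_t) = 2 b d₁/(P - W)³`). Lawler (2005), §6.3:
"`dU*_t = [κ/2 - 3] Φ_t''(U_t) dt + √κ Φ_t'(U_t) dB_t`". [cite: Lawler2005, §6.3] -/
theorem moebiusConj_drift (κ b P d₁ W : ℝ) :
    -3 * (2 * b * d₁ / (P - W) ^ 3) + κ / 2 * (2 * b * d₁ / (P - W) ^ 3) =
      (κ - 6) * (b * d₁ / (P - W) ^ 3) := by
  ring

/-- **The drift vanishes identically iff `κ = 6`** (`b d₁ ≠ 0`, `P ≠ W`): the driving function
`h_t(W_t)` of the Möbius image of the chordal Loewner chain of `√κ B` is a local martingale — and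
after the time change `∫ h_s'(W_s)² ds` a Brownian motion of speed `κ` — exactly for `κ = 6`.
Lawler (2005), §6.3, Thm. 6.13. [cite: Lawler2005, §6.3 Thm. 6.13] -/
theorem moebiusConj_drift_eq_zero_iff {κ b P d₁ W : ℝ} (hb : b ≠ 0) (hd₁ : d₁ ≠ 0) (hPW : P ≠ W) :
    -3 * (2 * b * d₁ / (P - W) ^ 3) + κ / 2 * (2 * b * d₁ / (P - W) ^ 3) = 0 ↔ κ = 6 := by
  rw [moebiusConj_drift]
  have hu : P - W ≠ 0 := sub_ne_zero.2 hPW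
  have hne : b * d₁ / (P - W) ^ 3 ≠ 0 := div_ne_zero (mul_ne_zero hb hd₁) (pow_ne_zero 3 hu)
  rw [mul_eq_zero, sub_eq_zero]
  exact ⟨fun h ↦ h.resolve_right hne, Or.inl⟩

/-- At `κ = 6` the drift is zero. [cite: Lawler2005, §6.3 Thm. 6.13] -/
theorem moebiusConj_drift_six (b P d₁ W : ℝ) :
    -3 * (2 * b * d₁ / (P - W) ^ 3) + 6 / 2 * (2 * b * d₁ / (P - W) ^ 3) = 0 := by
  rw [moebiusConj_drift]
  ring

/-! ### The conjugation at complex points and along Loewner trajectories -/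

/-- **The Möbius conjugation at complex arguments** `h_t(y) = a - b d₂/(2 d₁) + b d₁/(P - y)`,
`y ∈ ℍ` (the same closed form as `moebiusConj`, the parameters being real). [cite: Lawler2005, §4.6.1] -/
def moebiusConjC (a b P d₁ d₂ : ℝ) (y : ℂ) : ℂ :=
  (a : ℂ) - b * d₂ / (2 * d₁) + b * d₁ / ((P : ℂ) - y)

/-- Unfolding `moebiusConjC`. [folklore] -/
theorem moebiusConjC_apply (a b P d₁ d₂ : ℝ) (y : ℂ) :
    moebiusConjC a b P d₁ d₂ y = (a : ℂ) - b * d₂ / (2 * d₁) + b * d₁ / ((P : ℂ) - y) := rfl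

/-- On real arguments `moebiusConjC` is `moebiusConj`. [folklore] -/
theorem moebiusConjC_ofReal (a b P d₁ d₂ y : ℝ) :
    moebiusConjC a b P d₁ d₂ (y : ℂ) = ((moebiusConj a b P d₁ d₂ y : ℝ) : ℂ) := by
  rw [moebiusConjC_apply, moebiusConj_apply]
  push_cast
  ring

section Trajectory

variable {a b : ℝ} {P d₁ d₂ : ℝ → ℝ} {W t : ℝ}

/-- **The image of a Loewner trajectory solves the image Loewner equation** (Lawler (2005),
§4.6.1 / §6.3 "the maps `g*_t` satisfy the Loewner equation
`ġ*_t(z) = 2 Φ_t'(U_t)²/(g*_t(z) - U*_t)`"; LSW (2003) (5.1), Möbius case). Along differentiable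
`P, d₁, d₂` satisfying at time `t` the `x`-derivatives of Loewner's equation at the pole
(`Ṗ = 2/(P - W)`, `ḋ₁ = -2 d₁/(P - W)²`, `ḋ₂ = -2 d₂/(P - W)² + 4 d₁²/(P - W)³`, `P ≠ W`, `d₁ ≠ 0`)
and a complex trajectory `Y` of the Loewner flow (`Ẏ = 2/(Y - W)`, `Y ∉ {P, W}`), the image
point `h_t(Y_t)` moves by `d/dt h_t(Y_t) = 2 h_t'(W)²/(h_t(Y_t) - h_t(W))` with
`h_t'(W) = b d₁/(P - W)²`: after the time change `du = h_t'(W_t)² dt` this is Loewner's equation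
with driving function `W̃ = h_t(W_t)`. [cite: Lawler2005, §6.3] -/
theorem hasDerivAt_moebiusConjC_trajectory (hP : HasDerivAt P (2 / (P t - W)) t)
    (hd₁ : HasDerivAt d₁ (-2 * d₁ t / (P t - W) ^ 2) t)
    (hd₂ : HasDerivAt d₂ (-2 * d₂ t / (P t - W) ^ 2 + 4 * d₁ t ^ 2 / (P t - W) ^ 3) t)
    (hPW : P t ≠ W) (hd₁0 : d₁ t ≠ 0) {Y : ℝ → ℂ} (hY : HasDerivAt Y (2 / (Y t - W)) t)
    (hYP : Y t ≠ P t) (hYW : Y t ≠ W) :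
    HasDerivAt (fun s ↦ moebiusConjC a b (P s) (d₁ s) (d₂ s) (Y s))
      (2 * (((b * d₁ t / (P t - W) ^ 2 : ℝ) : ℂ)) ^ 2 /
        (moebiusConjC a b (P t) (d₁ t) (d₂ t) (Y t) - moebiusConjC a b (P t) (d₁ t) (d₂ t) W)) t := by
  have hu : ((P t : ℝ) : ℂ) - W ≠ 0 := sub_ne_zero.2 (by exact_mod_cast hPW)
  have hu' : P t - W ≠ 0 := sub_ne_zero.2 hPW
  have hv : ((P t : ℝ) : ℂ) - Y t ≠ 0 := sub_ne_zero.2 (Ne.symm hYP)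
  have hyw : Y t - W ≠ 0 := sub_ne_zero.2 hYW
  have hd₁0' : ((d₁ t : ℝ) : ℂ) ≠ 0 := by exact_mod_cast hd₁0
  -- the real coefficient processes, read in `ℂ`
  have hPc : HasDerivAt (fun s ↦ ((P s : ℝ) : ℂ)) (((2 / (P t - W) : ℝ) : ℂ)) t := hP.ofReal_comp
  have hd₁c : HasDerivAt (fun s ↦ ((d₁ s : ℝ) : ℂ)) (((-2 * d₁ t / (P t - W) ^ 2 : ℝ) : ℂ)) t :=
    hd₁.ofReal_comp
  have hd₂c : HasDerivAt (fun s ↦ ((d₂ s : ℝ) : ℂ))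
      (((-2 * d₂ t / (P t - W) ^ 2 + 4 * d₁ t ^ 2 / (P t - W) ^ 3 : ℝ) : ℂ)) t := hd₂.ofReal_comp
  have hA : HasDerivAt (fun s ↦ (b : ℂ) * d₂ s / (2 * d₁ s))
      (((b : ℂ) * ((-2 * d₂ t / (P t - W) ^ 2 + 4 * d₁ t ^ 2 / (P t - W) ^ 3 : ℝ) : ℂ) *
          (2 * ((d₁ t : ℝ) : ℂ)) -
        (b : ℂ) * d₂ t * (2 * (((-2 * d₁ t / (P t - W) ^ 2 : ℝ) : ℂ)))) /
        (2 * ((d₁ t : ℝ) : ℂ)) ^ 2) t :=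
    (hd₂c.const_mul (b : ℂ)).div (hd₁c.const_mul 2) (mul_ne_zero two_ne_zero hd₁0')
  have hden : HasDerivAt (fun s ↦ ((P s : ℝ) : ℂ) - Y s)
      ((((2 / (P t - W) : ℝ) : ℂ)) - 2 / (Y t - W)) t := hPc.sub hY
  have hB : HasDerivAt (fun s ↦ (b : ℂ) * d₁ s / (((P s : ℝ) : ℂ) - Y s))
      (((b : ℂ) * (((-2 * d₁ t / (P t - W) ^ 2 : ℝ) : ℂ)) * (((P t : ℝ) : ℂ) - Y t) -
        (b : ℂ) * d₁ t * ((((2 / (P t - W) : ℝ) : ℂ)) - 2 / (Y t - W))) /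
        (((P t : ℝ) : ℂ) - Y t) ^ 2) t :=
    (hd₁c.const_mul (b : ℂ)).div hden hv
  have hsum := ((hasDerivAt_const t (a : ℂ)).sub hA).add hB
  refine hsum.congr_deriv ?_
  -- the algebraic identity
  have hdiff : moebiusConjC a b (P t) (d₁ t) (d₂ t) (Y t) - moebiusConjC a b (P t) (d₁ t) (d₂ t) W =
      (b : ℂ) * d₁ t * (Y t - W) / ((((P t : ℝ) : ℂ) - Y t) * (((P t : ℝ) : ℂ) - W)) := by
    rw [moebiusConjC_apply, moebiusConjC_apply]
    field_simp
    ring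
  rw [hdiff]
  by_cases hb : b = 0
  · subst hb
    simp
  have hb' : (b : ℂ) ≠ 0 := by exact_mod_cast hb
  have hprod : (b : ℂ) * d₁ t * (Y t - W) / ((((P t : ℝ) : ℂ) - Y t) * (((P t : ℝ) : ℂ) - W)) ≠ 0 :=
    div_ne_zero (mul_ne_zero (mul_ne_zero hb' hd₁0') hyw) (mul_ne_zero hv hu)
  push_cast
  field_simp
  ring

end Trajectory

end Literature.Probability.RandomPlanarGeometry

end
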